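import Summits.AnomalousDissipation.AnomalousDissipation.Theorems.CubicParityLoud.Negative.MeanFlow
import Summits.AnomalousDissipation.AnomalousDissipation.Theorems.MomentParityCubicParityLoudFarkas
import Summits.AnomalousDissipation.AnomalousDissipation.Theorems.MomentParityCubicParityLoudCubicCasimir
import Summits.AnomalousDissipation.AnomalousDissipation.Theorems.MomentParityCubicParityLoudNoCasimirCertificate
import Summits.AnomalousDissipation.AnomalousDissipation.Theorems.MomentParityCubicParityLoudDiagonalClassification
import Summits.AnomalousDissipation.AnomalousDissipation.Theorems.MomentParityCubicParityLoudBalancedMenu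
import Literature.Analysis.FluidPDE.NSGalerkinFourier
import Literature.Analysis.FluidPDE.BeltramiWavesCurl

/-!
# Line `farkas-split-menu` for crux `MomentParity.CubicParityLoud` (stmt-AnomalousDissipation-11465)
# — the LEAD's skeleton (reshaped r1, 2026-08-16)

Lead `prover-line-stmt-AnomalousDissipation-11465-0`. Base: the checked planner skeleton
`Cruxes/CubicParityLoud/Lines/farkas-split-menu.lean` (planner-cruxplan-…-farkas-split-menu-0; idea card
`Ideas/farkas-split-menu.md`, crux-ideate r1 ideator 1; triage r1-1/2/3 pass). Two reshapes, both at the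
skeleton level, composition idea unchanged (REFUTE THE CERTIFICATE, DO NOT BUILD THE MEASURE):

1. The monolithic conjectural stub `stub_quadRigidity` (S3: quadratic Casimirs of the ball truncation
   `= span{E,H}` beyond a threshold, H-side) is DECOMPOSED into the three coefficient-side stubs of the
   triage-merged classification lever, taken byte-for-byte from the sibling checked skeleton
   `Lines/plane-wave-polarization-recursion.lean`: `stub_covariantVanishing` (S3a, the bet: momentum grading +
   no translation-covariant Casimir — since r2 DECOMPOSED by the lead into `stub_isotypeDecoupling` / `stub_killRules` /
   `stub_covariantClosure`, S3a itself now proved glue), `stub_diagonalClassification` (S3b: translation-invariant Casimirs are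
   `aE + bH`, Kraichnan 1973 made a theorem), `stub_coefficientBridge` (S3c: Parseval dictionary to the H-side
   QuadRigidity), together with that skeleton's two PROVED engine lemmas `localRank`, `isolationRank`.
   `quadRigidity_eventually` (the old S3, verbatim statement) is now PROVED from them (§ Glue).
2. The non-triviality clause of a weak certificate (hypothesis of S1 `stub_farkas`, last-but-two hypothesis
   of S4 `stub_noCasimirCertificate`) is made REPRESENTATION-FREE: `λ_b ≠ 0 ∨ λ_c ≠ 0 ∨` the ROW
   `u ↦ ⟨F_ν(u), ∇p(u)⟩` is not identically zero on level-`N` fields (was: the observable `p` is non-constant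
   on level-`N` fields). Why: S1 obtains the certificate by finite-dimensional separation in the span `W` of the
   row vectors, which yields exactly a functional non-zero ON `W` — i.e. a test whose row does not vanish
   identically — whereas "p non-constant" is not implied when the test fields are an overcomplete Parseval
   frame (`Torus.frameField`: both `±k`, three directions per `k`); and S4's contradiction is literally
   "the row vanishes identically" (α = β = 0, then `G₀ = 0` by the sign lemma and `ν > 0`), so the new clause
   is what S4 refutes with no detour through values of `p` along segments.

## The line in one paragraph (unchanged)

At fixed `(f, ν, N, E, ε)` the crux asks for a point of `conv{Ψ(u) : u ∈ V_N}`,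
`Ψ(u) = (rows(u), |u|², ν‖∇u‖²)`, in the closed convex target `{rows = 0} × (−∞,E] × [ε,∞)`; a point of the
intersection IS a finitely atomic level-`N` witness (S1 `stub_farkas`), otherwise a WEAK CERTIFICATE
`⟨F_ν(u), ∇p(u)⟩ + λ_b(E − |u|²) + λ_c(ν‖∇u‖² − ε) ≤ 0` on all level-`N` fields, `deg p ≤ 2`, exists; its cubic
part vanishes (S2 `stub_cubicCasimir`: the quadratic part `p₂` is a quadratic CASIMIR of ball-truncated Euler);
by the classification (S3a–c ⇒ `quadRigidity_eventually`) `∇p₂(u) = 2αP_N u + 2β curl P_N u` beyond `N₁`, and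
the certificate is killed (S4 `stub_noCasimirCertificate`) by integrating it against the two-dial MENU of
1-stationary laws with slack (S5 `stub_balancedMenu`: mean flow on one forced mode, four-phase stress packets,
a chiral Taylor-shell sea; first and second moments of an explicit atom cloud only).
Composition `CubicParityLoud_of`: constants `(E + 1, ε, ν₀)` from S5, threshold `max N₀^menu(ν) N₁`.

## Infrastructure the stubs should REUSE (landed Theorems of the sibling crux QuarticGate, importable)

`MomentParityQuarticGateBasis` (orthonormal band basis `exists_bandBasis` of `V_N`),
`…Coords` (coordinates, synthesis `exists_level_of_coords`, `coe_ae_eq_sum_of_level`), `…RowPoly`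
(`exists_rowPoly`: the row of a degree-`d` test is a degree-`≤ d+1` polynomial in the coordinates whose top
component is the Euler pairing of the top component of the test), `…Rows` (`polyGrad_transport`,
`polyGrad_sum_smul`, `nsGeneratorPairing_polyGrad_sum_smul`), `…Budget` (energy / dissipation as quadratic
polynomials of the coordinates), `…AtomicMeasure` (finite averages of Diracs on `H`), `…AtomRows`
(rows of the generator at trigonometric-polynomial atoms in Fourier variables: level, `P_N U`, `‖U‖²`, `‖∇U‖²`,
linear / energy / helicity rows), `…ModeCalculus` (single real modes, `convectionCoeff` / `curlCoeff` on them,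
sign and quarter-turn phase averages), `…SignLemma` (`stub_signLemma`, PROVED: a one-signed Euler derivative of a
polynomial observable vanishes), `…Helicity` (`inertialPairing_coe_curl_eq_zero`), `…PolyCalc` / `…Transport`
/ `…DefectPoly` (`MvPolynomial` bookkeeping: `bind₁` of linear forms, chain rule, homogeneity, degrees).

## Disproof.lean used (tree `Cruxes/CubicParityLoud/Disproof.lean`, cdisprove cycle 1–2, read in full 2026-08-16T03:40Z)

NO KILL; §0–§9 landed as `Theorems/CubicParityLoud/Negative/{Clauses,EnergyRow,LoadBearing,Anatomy,MeanFlow}`,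
all IMPORTED here (`Negative.MeanFlow`). `cubicParityLoud_false_without_nonzero/_divFree/_zeroMean`: the three
hypotheses are consumed by S5 only (forced transversal mode `p₀`); `not_cubicParityLoudUniformLevel` / §1
Bernstein: S5 chooses `N₀ = 2K(ν) ≍ ν^{-1/2}` after `ν`; `not_cubicParityLoudUniformInForce`: S5's constants
depend on `f̂(p₀)`, `Σ_q|q||f̂(q)|`; `not_cubicParityLoudAllViscosities`: S5 carries `ν₀`;
`IsWitness.dissipation_eq` (§2 energy row): the menu's dissipation is `(f,m) − a`; `IsWitness.map_neg_ne`: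
menu and Carathéodory witness carry the mean flow. No `-- Targets` section exists yet. No stub is an instance of a
refuted `CubicParityLoud*` strengthening (S5 has the crux's own quantifier shape; S1/S2/S4 are pointwise in
`(f, ν, N)`; S3a–c are force-free).
-/

noncomputable section

namespace Summit.AnomalousDissipation.AnomalousDissipation.Cruxes.CubicParityLoud.FarkasSplitMenu

open MeasureTheory Filter UnitAddTorus
open scoped InnerProductSpace RealInnerProductSpace ENNReal
open Literature.Analysis.FunctionSpaces Literature.Analysis.FluidPDE
open Summit.AnomalousDissipation.AnomalousDissipation.Theses.MomentParity
open Summit.AnomalousDissipation.AnomalousDissipation.Theorems.CubicParityLoud.Negative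

set_option linter.dupNamespace false

/-! ## The two LOCAL ENGINE LEMMAS of the classification — proved (sorry-free, standard axioms)

Copied verbatim from `Lines/plane-wave-polarization-recursion.lean` (planner
`planner-cruxplan-stmt-AnomalousDissipation-11465-plane-wave-polarizat-0`), whose S3 is fed them as hypotheses.

Both are pure real linear algebra in `ℝ³` (Mathlib `dotProduct` / `crossProduct`); they are the
`N`-uniform certificates of the line (card `LocalRankLemma`; triage r1-2 maps (A), (B)).  The lead
should land them first, verbatim, as `Theorems/MomentParityCubicParityLoudLocalRank.lean`
(`--supports stmt-AnomalousDissipation-11465`); the prover of `stub_covariantVanishing` then cites them. -/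

section Engine

open Matrix

/-- A vector orthogonal to `k`, `d` and `k × d` vanishes when `k × d ≠ 0` (Lagrange's identity
`|m × c|² = |m|²|c|² − (m·c)²` with `c = k × d`, and `m × (k × d) = (m·d)k − (m·k)d`). [folklore] -/
theorem eq_zero_of_perp (k d m : Fin 3 → ℝ) (hkd : crossProduct k d ≠ 0)
    (hk : dotProduct m k = 0) (hd : dotProduct m d = 0) (hc : dotProduct m (crossProduct k d) = 0) :
    m = 0 := by
  have hcc : dotProduct (crossProduct k d) (crossProduct k d) ≠ 0 :=
    fun h0 => hkd (dotProduct_self_eq_zero.1 h0)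
  have hcross : crossProduct m (crossProduct k d) = 0 := by
    rw [cross_cross_eq_smul_sub_smul', hd, dotProduct_comm, hk, zero_smul, zero_smul, sub_zero]
  have hlag := cross_dot_cross m (crossProduct k d) m (crossProduct k d)
  rw [hcross, dotProduct_zero, hc, zero_mul, sub_zero] at hlag
  exact dotProduct_self_eq_zero.1 ((mul_eq_zero.1 hlag.symm).resolve_right hcc)

/-- Reciprocal-basis expansion in `ℝ³`:
`(u·(v×w)) x = (x·(v×w)) u + (x·(w×u)) v + (x·(u×v)) w`. [folklore] -/
theorem triple_decomp (u v w x : Fin 3 → ℝ) :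
    (dotProduct u (crossProduct v w)) • x =
      (dotProduct x (crossProduct v w)) • u + (dotProduct x (crossProduct w u)) • v +
        (dotProduct x (crossProduct u v)) • w := by
  simp_rw [cross_apply, vec3_dotProduct]
  ext i
  fin_cases i <;>
  · simp only [Fin.isValue, Nat.succ_eq_add_one, Nat.reduceAdd, Fin.reduceFinMk, cons_val,
      Pi.add_apply, Pi.smul_apply, smul_eq_mul, Fin.zero_eta, Fin.mk_one, cons_val_zero, cons_val_one]
    ring

/-- **THREE-WAVE (isolation-round) RANK LEMMA — proved** (triage r1-2 map (B), r1-3 merge note; was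
the card's second engine).  For real frequencies `a ∦ b` with `|a|² ≠ |b|²`: a vector `n ⊥ a + b`
orthogonal to every `(x·b) y + (y·a) x` (`x ⊥ a`, `y ⊥ b`) — the symmetric convection symbol of the two
plane waves — is zero; i.e. the block `S(a+b, ·)` of a Casimir is pinned by ONE three-mode identity once
its two side blocks are cleared.  (Kernel `ℝ(a − b)` exactly when `|a| = |b|`: the isosceles exception
of the isolation round.)  Proof: test pairs `(a×b, b×(a×b))` and `(a×(a×b), b×(a×b))` give
`n·(a×b) = 0` and `|a×b|²(|a|²−|b|²)(n·a) = 0`. [folklore] -/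
theorem isolationRank (a b n : Fin 3 → ℝ) (hab : crossProduct a b ≠ 0)
    (hnorm : dotProduct a a ≠ dotProduct b b) (hn : dotProduct n (a + b) = 0)
    (h : ∀ x y : Fin 3 → ℝ, dotProduct x a = 0 → dotProduct y b = 0 →
      dotProduct x b * dotProduct n y + dotProduct y a * dotProduct n x = 0) : n = 0 := by
  set c : Fin 3 → ℝ := crossProduct a b with hc
  have hcc : dotProduct c c ≠ 0 := fun h0 => hab (dotProduct_self_eq_zero.1 h0)
  -- orthogonality of the test vectors
  have hca : dotProduct c a = 0 := by rw [hc, dotProduct_comm]; exact dot_self_cross a b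
  have hcb : dotProduct c b = 0 := by rw [hc, dotProduct_comm]; exact dot_cross_self a b
  have hxa : dotProduct (crossProduct a c) a = 0 := by rw [dotProduct_comm]; exact dot_self_cross a c
  have hyb : dotProduct (crossProduct b c) b = 0 := by rw [dotProduct_comm]; exact dot_self_cross b c
  -- triple products against the test vectors
  have h_bca : dotProduct (crossProduct b c) a = dotProduct c c := by
    rw [dotProduct_comm, triple_product_permutation, triple_product_permutation]
  have h_acb : dotProduct (crossProduct a c) b = -dotProduct c c := by
    rw [dotProduct_comm, triple_product_permutation, triple_product_permutation, ← cross_anticomm,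
      dotProduct_neg]
  -- Step 1: `n ⬝ c = 0`
  have h1 := h c (crossProduct b c) hca hyb
  rw [hcb, zero_mul, zero_add, h_bca] at h1
  have hnc : dotProduct n c = 0 := (mul_eq_zero.1 h1).resolve_left hcc
  -- Step 2: `n ⬝ a = n ⬝ b = 0`
  have h2 := h (crossProduct a c) (crossProduct b c) hxa hyb
  rw [h_acb, h_bca] at h2
  have hac : crossProduct a c = (dotProduct a b) • a - (dotProduct a a) • b := by
    rw [hc, cross_cross_eq_smul_sub_smul']
  have hbc : crossProduct b c = (dotProduct b b) • a - (dotProduct a b) • b := by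
    rw [hc, cross_cross_eq_smul_sub_smul']
  rw [hac, hbc] at h2
  simp only [dotProduct_sub, dotProduct_smul, smul_eq_mul] at h2
  rw [dotProduct_add] at hn
  have hkey : dotProduct c c * (dotProduct a a - dotProduct b b) * dotProduct n a = 0 := by
    linear_combination h2 - dotProduct c c * (dotProduct a b - dotProduct a a) * hn
  have hna : dotProduct n a = 0 := by
    rcases mul_eq_zero.1 hkey with h' | h'
    · rcases mul_eq_zero.1 h' with h'' | h''
      · exact absurd h'' hcc
      · exact absurd (sub_eq_zero.1 h'') hnorm
    · exact h'
  have hnb : dotProduct n b = 0 := by linarith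
  -- Step 3: `n ⊥ a, b, a × b`
  refine eq_zero_of_perp a b n hab hna hnb ?_
  rw [← hc]; exact hnc

/-- **LOCAL RANK LEMMA — proved** (chain / one-shot engine; the card's `LocalRankLemma` verbatim,
re-derived on paper by all three triagers; exact tables `local_rank.py`, `localrank_check.py` on the
item).  For real frequencies `k ∦ d` with `|k|² ≠ |d|²`, a real block `M : k^⊥ → (k+d)^⊥` (`M k = 0`,
`(k+d)ᵀ M = 0`) annihilated by the single-plane-wave identity against the wave at `d`,
`(v·d)(ω·Mv) + (ω·k)(v·Mv) = 0` for all `v ⊥ k`, `ω ⊥ d`, vanishes.  (Kernel `(k−d) ⊗ α` exactly on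
the sphere `|k| = |d|`; void for `k ∥ d`.)  Proof: with `c = k×d`, `Δ = |c|²`, the test directions
`ω ∈ {c, d×c}` and `v ∈ {k×c, c + k×c}` give `Δ(|k|²−|d|²)(k·Mv) = 0`, hence `Mv ⊥ k, d, c`, so `M`
kills `k×c`, `c`, then `d` (from `k×c = (k·d)k − |k|²d`), then everything (reciprocal basis). [folklore] -/
theorem localRank (k d : Fin 3 → ℝ) (M : Matrix (Fin 3) (Fin 3) ℝ) (hkd : crossProduct k d ≠ 0)
    (hnorm : dotProduct k k ≠ dotProduct d d) (hMk : M.mulVec k = 0) (hrange : Matrix.vecMul (k + d) M = 0)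
    (h : ∀ v ω : Fin 3 → ℝ, dotProduct v k = 0 → dotProduct ω d = 0 →
      dotProduct v d * dotProduct ω (M.mulVec v) + dotProduct ω k * dotProduct v (M.mulVec v) = 0) :
    M = 0 := by
  set c : Fin 3 → ℝ := crossProduct k d with hc
  set Δ : ℝ := dotProduct c c with hΔ
  have hΔ0 : Δ ≠ 0 := fun h0 => hkd (dotProduct_self_eq_zero.1 h0)
  have hΔ' : Δ = dotProduct k k * dotProduct d d - dotProduct k d * dotProduct d k := by
    rw [hΔ, hc, cross_dot_cross]
  -- range condition: `d ⬝ Mv = -(k ⬝ Mv)`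
  have hR : ∀ v : Fin 3 → ℝ, dotProduct d (M.mulVec v) = -dotProduct k (M.mulVec v) := by
    intro v
    have h0 : dotProduct (k + d) (M.mulVec v) = 0 := by rw [dotProduct_mulVec, hrange, zero_dotProduct]
    rw [add_dotProduct] at h0
    linarith
  -- test vectors
  have hck : dotProduct c k = 0 := by rw [hc, dotProduct_comm]; exact dot_self_cross k d
  have hcd : dotProduct c d = 0 := by rw [hc, dotProduct_comm]; exact dot_cross_self k d
  set ω₂ : Fin 3 → ℝ := crossProduct d c with hω₂
  have hω₂d : dotProduct ω₂ d = 0 := by rw [hω₂, dotProduct_comm]; exact dot_self_cross d c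
  have hω₂' : ω₂ = (dotProduct d d) • k - (dotProduct k d) • d := by rw [hω₂, hc, cross_cross_eq_smul_sub_smul']
  have hω₂k : dotProduct ω₂ k = Δ := by
    rw [hω₂', sub_dotProduct, smul_dotProduct, smul_dotProduct, smul_eq_mul, smul_eq_mul, hΔ',
      dotProduct_comm d k]
    ring
  set v₂ : Fin 3 → ℝ := crossProduct k c with hv₂
  have hv₂k : dotProduct v₂ k = 0 := by rw [hv₂, dotProduct_comm]; exact dot_self_cross k c
  have hv₂' : v₂ = (dotProduct k d) • k - (dotProduct k k) • d := by rw [hv₂, hc, cross_cross_eq_smul_sub_smul']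
  have hv₂d : dotProduct v₂ d = -Δ := by
    rw [hv₂', sub_dotProduct, smul_dotProduct, smul_dotProduct, smul_eq_mul, smul_eq_mul, hΔ',
      dotProduct_comm d k]
    ring
  -- the two identities: ★1 with `ω = c`, ★2 with `ω = ω₂ = d × c`
  have star1 : ∀ v : Fin 3 → ℝ, dotProduct v k = 0 → dotProduct v d * dotProduct c (M.mulVec v) = 0 := by
    intro v hv
    have := h v c hv hcd
    rwa [hck, zero_mul, add_zero] at this
  have star2 : ∀ v : Fin 3 → ℝ, dotProduct v k = 0 →
      dotProduct v d * (dotProduct d d * dotProduct k (M.mulVec v) - dotProduct k d * dotProduct d (M.mulVec v)) +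
        Δ * dotProduct v (M.mulVec v) = 0 := by
    intro v hv
    have := h v ω₂ hv hω₂d
    rwa [hω₂k, hω₂', sub_dotProduct, smul_dotProduct, smul_dotProduct, smul_eq_mul, smul_eq_mul] at this
  have hv₂M : ∀ v : Fin 3 → ℝ, dotProduct v₂ (M.mulVec v) =
      dotProduct k d * dotProduct k (M.mulVec v) - dotProduct k k * dotProduct d (M.mulVec v) := by
    intro v
    rw [hv₂', sub_dotProduct, smul_dotProduct, smul_dotProduct, smul_eq_mul, smul_eq_mul]
  -- Step A: `M v₂ = 0`
  have hA : M.mulVec v₂ = 0 := by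
    have h2 := star2 v₂ hv₂k
    rw [hv₂d, hv₂M v₂, hR v₂] at h2
    have hσ : Δ * (dotProduct k k - dotProduct d d) * dotProduct k (M.mulVec v₂) = 0 := by
      linear_combination h2
    have hk0 : dotProduct k (M.mulVec v₂) = 0 := by
      rcases mul_eq_zero.1 hσ with h' | h'
      · rcases mul_eq_zero.1 h' with h'' | h''
        · exact absurd h'' hΔ0
        · exact absurd (sub_eq_zero.1 h'') hnorm
      · exact h'
    have hd0 : dotProduct d (M.mulVec v₂) = 0 := by rw [hR v₂, hk0, neg_zero]
    have hc0 : dotProduct c (M.mulVec v₂) = 0 := by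
      have h1 := star1 v₂ hv₂k
      rw [hv₂d] at h1
      exact (mul_eq_zero.1 h1).resolve_left (neg_ne_zero.2 hΔ0)
    refine eq_zero_of_perp k d _ hkd ?_ ?_ ?_
    · rw [dotProduct_comm]; exact hk0
    · rw [dotProduct_comm]; exact hd0
    · rw [dotProduct_comm]; exact hc0
  -- Step B: `M c = 0` via `v₃ = c + v₂`
  have hcMc : dotProduct c (M.mulVec c) = 0 := by
    have h2 := star2 c hck
    rw [hcd, zero_mul, zero_add] at h2
    exact (mul_eq_zero.1 h2).resolve_left hΔ0
  have hB : M.mulVec c = 0 := by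
    have hv₃k : dotProduct (c + v₂) k = 0 := by rw [add_dotProduct, hck, hv₂k, add_zero]
    have hv₃d : dotProduct (c + v₂) d = -Δ := by rw [add_dotProduct, hcd, hv₂d, zero_add]
    have hMv₃ : M.mulVec (c + v₂) = M.mulVec c := by rw [Matrix.mulVec_add, hA, add_zero]
    have h2 := star2 (c + v₂) hv₃k
    rw [hv₃d, hMv₃, add_dotProduct, hcMc, zero_add, hv₂M c, hR c] at h2
    have hσ : Δ * (dotProduct k k - dotProduct d d) * dotProduct k (M.mulVec c) = 0 := by
      linear_combination h2
    have hk0 : dotProduct k (M.mulVec c) = 0 := by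
      rcases mul_eq_zero.1 hσ with h' | h'
      · rcases mul_eq_zero.1 h' with h'' | h''
        · exact absurd h'' hΔ0
        · exact absurd (sub_eq_zero.1 h'') hnorm
      · exact h'
    have hd0 : dotProduct d (M.mulVec c) = 0 := by rw [hR c, hk0, neg_zero]
    refine eq_zero_of_perp k d _ hkd ?_ ?_ ?_
    · rw [dotProduct_comm]; exact hk0
    · rw [dotProduct_comm]; exact hd0
    · rw [dotProduct_comm]; exact hcMc
  -- Step C: `M d = 0` (from `v₂ = (k·d)k − |k|²d`)
  have hkk : dotProduct k k ≠ 0 := by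
    intro h0
    have hk0 : k = 0 := dotProduct_self_eq_zero.1 h0
    apply hkd
    rw [hc, hk0, map_zero, LinearMap.zero_apply]
  have hC : M.mulVec d = 0 := by
    have h0 : M.mulVec v₂ = (dotProduct k d) • M.mulVec k - (dotProduct k k) • M.mulVec d := by
      rw [hv₂', Matrix.mulVec_sub, Matrix.mulVec_smul, Matrix.mulVec_smul]
    rw [hA, hMk, smul_zero, zero_sub, eq_comm, neg_eq_zero, smul_eq_zero] at h0
    exact h0.resolve_left hkk
  -- Step D: `M = 0` by the reciprocal-basis expansion along `k, d, c`
  have hkdc : dotProduct k (crossProduct d c) = Δ := by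
    rw [triple_product_permutation, triple_product_permutation]
  have hall : ∀ x : Fin 3 → ℝ, M.mulVec x = 0 := by
    intro x
    have hdec := triple_decomp k d c x
    rw [hkdc] at hdec
    have h1 : M.mulVec (Δ • x) = 0 := by
      rw [hdec, Matrix.mulVec_add, Matrix.mulVec_add, Matrix.mulVec_smul, Matrix.mulVec_smul,
        Matrix.mulVec_smul, hMk, hC, ← hc, hB, smul_zero, smul_zero, smul_zero, add_zero, add_zero]
    rw [Matrix.mulVec_smul] at h1
    exact (smul_eq_zero.1 h1).resolve_left hΔ0
  ext i j
  have := congrFun (hall (Pi.single j 1)) i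
  rw [Matrix.mulVec_single_one] at this
  simpa using this

end Engine

/-! ## The duality stubs S1, S2 (finite-dimensional; S1 reshaped) -/

/-- **S1 — `stub_farkas`: DEGREE-3 CONIC DUALITY + CARATHÉODORY (the split).** At fixed
`(f, ν, N, E, ε)`: if there is NO weak certificate — no polynomial cylindrical test `(g, P)` with
level-`N` band-limited fields and `deg P ≤ 2`, and multipliers `λ_b, λ_c ≥ 0`, non-trivial
(`λ_b ≠ 0`, or `λ_c ≠ 0`, or the ROW `u ↦ ⟨F_ν(u), ∇p(u)⟩` is not identically zero on level-`N`
fields — RESHAPED by the lead, see the file header), such that `⟨F_ν(u), ∇p(u)⟩ + λ_b (E − ‖u‖²) + λ_c (ν‖∇u‖² − ε) ≤ 0` at EVERY level-`N` field —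
then a witness of the crux at `(f, ν, N, E, ε)` exists (and may be taken finitely atomic).
Why true: `V_N` (level-`N` fields) is finite-dimensional (frame `Torus.frameField`, coordinates
`pairing_eq_sum_frameG`); the row of `(g, P)` at a level-`N` field depends on `(g, P)` only through the
polynomial FUNCTION `p|_{V_N}` modulo constants (`∇p(u)` is the `V_N`-gradient of `p|_{V_N}`), so the rows
form a finite-dimensional space `R = L(Q)`, `Q` = polynomial functions of degree `≤ 2` on `V_N` vanishing
at `0`; with `Ψ(u) = ((q ↦ L(q)(u)) ∈ Q*, ‖u‖², ν‖∇u‖²)`, either `conv Ψ(V_N)` meets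
`T = {0} × (−∞,E] × [ε,∞)` — then `Σⱼ wⱼ δ_{uⱼ}` is a witness: probability, level-`N`, `‖u‖³`
integrable (`integrable_dirac`), every row `= Σⱼ wⱼ L(q)(uⱼ) = 0`, `ensembleEnergy = Σ wⱼ‖uⱼ‖² ≤ E`,
`ensembleDissipation = ν Σ wⱼ ‖∇uⱼ‖² ≥ ε` — or, separating the compact convex `conv Ψ(B_ρ)` from the
closed convex `T` for every radius `ρ` (`geometric_hahn_banach_compact_closed`; signs of the `T`-part
from its recession directions), normalising and passing to the limit `ρ → ∞` on the unit sphere of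
`Q × ℝ × ℝ`, a non-zero `(q, λ_b, λ_c)` with the weak inequality on all of `V_N`; realise `q` as
`(frameG N, P)` with `deg P ≤ 2` (`q ≠ 0`, `q(0) = 0` ⇒ non-constant). Size M–L (finite-dimensional
convex geometry in Mathlib + atomic-measure and frame bookkeeping). -/
theorem stub_farkas :
    ∀ f : T3 → R3, Torus.IsSmooth f → ∀ (ν : ℝ) (N : ℕ) (E ε : ℝ),
      (¬ ∃ (m : ℕ) (g : Fin m → T3 → R3) (P : MvPolynomial (Fin m) ℝ) (lb lc : ℝ),
          (∀ i, IsBandTest N (g i)) ∧ P.totalDegree ≤ 2 ∧ 0 ≤ lb ∧ 0 ≤ lc ∧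
          (lb ≠ 0 ∨ lc ≠ 0 ∨ ∃ u : H3, IsLevel N u ∧
              Torus.nsGeneratorPairing ν f u (polyGrad g P u) ≠ 0) ∧
          ∀ u : H3, IsLevel N u →
            Torus.nsGeneratorPairing ν f u (polyGrad g P u) + lb * (E - ‖u‖ ^ 2) +
              lc * (ν * (Torus.eGradNormSq ((u : L2T3) : T3 → R3)).toReal - ε) ≤ 0) →
      ∃ μ : Measure H3, IsWitness f ν N E ε μ :=
  Summit.AnomalousDissipation.AnomalousDissipation.Theorems.MomentParityCubicParityLoud.stub_farkas

/-- **S2 — `stub_cubicCasimir`: THE CUBIC PART OF A WEAK CERTIFICATE VANISHES ("order 3 is free",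
dual form).** If `⟨F_ν(u), ∇p(u)⟩ + λ_b (E − ‖u‖²) + λ_c (ν‖∇u‖² − ε) ≤ 0` at every level-`N` field
for a test `(g, P)` with band-limited fields and `deg P ≤ 2`, then the quadratic part
`p₂ = homogeneousComponent 2 P` of the test is a QUADRATIC CASIMIR of level-`N` Galerkin–Euler:
its Euler derivative `⟨F₀(u), ∇p₂(u)⟩ = −(B(u,u), ∇p₂(u))` (`Torus.nsGeneratorPairing 0 0`) vanishes at
every level-`N` field.
Why true: level-`N` fields are stable under `u ↦ t • u`; along that ray the certificate is a real cubic
polynomial in `t` — `(f, ∇p(tu)) = O(t)`, `ν(tu, Δ∇p(tu))`, `∫(tu⊗tu):∇(∇p(0))`, `λ_b t²‖u‖²`,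
`λ_c ν t²‖∇u‖²` are `O(t²)`, and the `t³`-coefficient is `∫(u⊗u):∇(∇p₂(u))` because
`∇p(tu) = ∇p(0) + t ∇p₂(u)` for `deg P ≤ 2` (`pderiv` of `homogeneousComponent`, `polyGrad` is a finite
`sum_smul`, `nsGeneratorPairing_sum_smul`); a cubic bounded above on `ℝ` has zero leading coefficient.
Size M (homogeneity bookkeeping of the three pairings under scaling in `H`, `MvPolynomial` degree
algebra). -/
theorem stub_cubicCasimir :
    ∀ f : T3 → R3, Torus.IsSmooth f → ∀ (ν : ℝ) (N : ℕ) (E ε lb lc : ℝ)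
      (m : ℕ) (g : Fin m → T3 → R3) (P : MvPolynomial (Fin m) ℝ),
      (∀ i, IsBandTest N (g i)) → P.totalDegree ≤ 2 →
      (∀ u : H3, IsLevel N u →
          Torus.nsGeneratorPairing ν f u (polyGrad g P u) + lb * (E - ‖u‖ ^ 2) +
            lc * (ν * (Torus.eGradNormSq ((u : L2T3) : T3 → R3)).toReal - ε) ≤ 0) →
      ∀ u : H3, IsLevel N u →
        Torus.nsGeneratorPairing (d := Fin 3) 0 0 u
          (polyGrad g (MvPolynomial.homogeneousComponent 2 P) u) = 0 :=
  Summit.AnomalousDissipation.AnomalousDissipation.Theorems.MomentParityCubicParityLoud.stub_cubicCasimir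

/-! ## S3 decomposed (coefficient side): the classification of the quadratic Casimirs — stubs S3a, S3b — and the Parseval bridge S3c

Statements byte-identical with `stub_covariantVanishing` / `stub_diagonalClassification` /
`stub_coefficientBridge` of the sibling skeleton `Lines/plane-wave-polarization-recursion.lean`
(triage-merged classification lever shared by all three lines of this crux). -/

/-- **S3a-i `stub_isotypeDecoupling` — MOMENTUM GRADING (size M; reshaped out of the old S3a by the lead).**
For every kernel `A` whose real form `Q_A(c) = Σ_{k,l∈S} Re⟪c k, A k l (c l)⟫` (S = punctured ball of level `N`) is a
quadratic Casimir of Galerkin–Euler (its drift along `k ↦ leraySym k (convectionCoeff S c c k)` vanishes at every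
admissible `c`): (1) its block-diagonal part is a Casimir; (2) for every defect `d ≠ 0` the TRUNCATION of `A` to the entries
`(k,l)` with `l − k ∈ {d, −d}` is a Casimir; (3) (no hypothesis needed) the form regroups by defect:
`Q_A = Q_diag + ½ Σ_{d ∈ [−2N,2N]³, d ≠ 0} Q_{A^[d]}` on admissible `c`.
Why true: admissibility is invariant under the torus characters `(τ_a c) k := mFourier k a • c k` (`a ∈ T³`), the Euler
field is equivariant (`convectionCoeff` sums over `l + m = k`, `mFourier_add`; `leraySym_smul`), so the drift at `τ_a c` is
the real trigonometric polynomial `a ↦ Σ_{k,l} Re (mFourier (l − k) a · Z_kl(c))`; it vanishes identically, hence so does each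
Fourier mode: integrate against `1` and against `mFourier (−d)` over `T³` (`Torus.integral_mFourier`,
`integral_mFourier_neg_mul_mFourier`, TorusTrigPoly) — giving (1) and (2); (3) is `Finset.sum` bookkeeping
(partition the pairs `(k,l)` by `l − k`, pair `d` with `−d`). -/
theorem stub_isotypeDecoupling :
    ∀ (N : ℕ) (A : ((Fin 3 → ℤ) → (Fin 3 → ℤ) → (EuclideanSpace ℂ (Fin 3) →ₗ[ℂ] EuclideanSpace ℂ (Fin 3)))),
      (∀ c : (Fin 3 → ℤ) → EuclideanSpace ℂ (Fin 3), (Torus.IsConjSymm c ∧ Torus.IsTransversal ((Torus.freqBall N).erase (0 : Fin 3 → ℤ)) c ∧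
          ∀ k ∉ ((Torus.freqBall N).erase (0 : Fin 3 → ℤ)), c k = 0) →
          ∑ k ∈ ((Torus.freqBall N).erase (0 : Fin 3 → ℤ)), ∑ l ∈ ((Torus.freqBall N).erase (0 : Fin 3 → ℤ)),
            ((inner ℂ (Torus.leraySym k (Torus.convectionCoeff ((Torus.freqBall N).erase (0 : Fin 3 → ℤ)) c c k)) (A k l (c l))).re +
              (inner ℂ (c k) (A k l (Torus.leraySym l (Torus.convectionCoeff ((Torus.freqBall N).erase (0 : Fin 3 → ℤ)) c c l)))).re) = 0) →
      (∀ c : (Fin 3 → ℤ) → EuclideanSpace ℂ (Fin 3), (Torus.IsConjSymm c ∧ Torus.IsTransversal ((Torus.freqBall N).erase (0 : Fin 3 → ℤ)) c ∧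
          ∀ k ∉ ((Torus.freqBall N).erase (0 : Fin 3 → ℤ)), c k = 0) →
          ∑ k ∈ ((Torus.freqBall N).erase (0 : Fin 3 → ℤ)),
            ((inner ℂ (Torus.leraySym k (Torus.convectionCoeff ((Torus.freqBall N).erase (0 : Fin 3 → ℤ)) c c k)) ((A k k) (c k))).re +
              (inner ℂ (c k) ((A k k) (Torus.leraySym k (Torus.convectionCoeff ((Torus.freqBall N).erase (0 : Fin 3 → ℤ)) c c k)))).re) = 0) ∧
      (∀ d : Fin 3 → ℤ, d ≠ 0 →
        (∀ c : (Fin 3 → ℤ) → EuclideanSpace ℂ (Fin 3), (Torus.IsConjSymm c ∧ Torus.IsTransversal ((Torus.freqBall N).erase (0 : Fin 3 → ℤ)) c ∧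
          ∀ k ∉ ((Torus.freqBall N).erase (0 : Fin 3 → ℤ)), c k = 0) →
            ∑ k ∈ ((Torus.freqBall N).erase (0 : Fin 3 → ℤ)), ∑ l ∈ ((Torus.freqBall N).erase (0 : Fin 3 → ℤ)),
              ((inner ℂ (Torus.leraySym k (Torus.convectionCoeff ((Torus.freqBall N).erase (0 : Fin 3 → ℤ)) c c k)) ((fun k l => if l - k = d ∨ l - k = -d then A k l else 0) k l (c l))).re +
                (inner ℂ (c k) ((fun k l => if l - k = d ∨ l - k = -d then A k l else 0) k l (Torus.leraySym l (Torus.convectionCoeff ((Torus.freqBall N).erase (0 : Fin 3 → ℤ)) c c l)))).re) = 0)) ∧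
      (∀ c : (Fin 3 → ℤ) → EuclideanSpace ℂ (Fin 3), (Torus.IsConjSymm c ∧ Torus.IsTransversal ((Torus.freqBall N).erase (0 : Fin 3 → ℤ)) c ∧
          ∀ k ∉ ((Torus.freqBall N).erase (0 : Fin 3 → ℤ)), c k = 0) →
        (∑ k ∈ ((Torus.freqBall N).erase (0 : Fin 3 → ℤ)), ∑ l ∈ ((Torus.freqBall N).erase (0 : Fin 3 → ℤ)), (inner ℂ (c k) (A k l (c l))).re) =
          (∑ k ∈ ((Torus.freqBall N).erase (0 : Fin 3 → ℤ)), (inner ℂ (c k) ((A k k) (c k))).re) +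
            (1 / 2 : ℝ) * ∑ d ∈ (Fintype.piFinset fun _ : Fin 3 => Finset.Icc (-(2 * (N : ℤ))) (2 * (N : ℤ))).erase 0,
              (∑ k ∈ ((Torus.freqBall N).erase (0 : Fin 3 → ℤ)), ∑ l ∈ ((Torus.freqBall N).erase (0 : Fin 3 → ℤ)), (inner ℂ (c k) ((fun k l => if l - k = d ∨ l - k = -d then A k l else 0) k l (c l))).re)) := by
  sorry

/-- **S3a-ii `stub_killRules` — THE THREE LOCAL KILL RULES for a defect-`d` kernel (size L; reshaped out of the old S3a).**
Fed the two engines (PROVED above, kept as hypotheses), for `d ≠ 0` and a kernel `A` SUPPORTED on the defects `±d`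
(`A k l = 0` unless `l − k = ±d`) whose form is a Casimir, define for `x ∈ ℤ³` the EFFECTIVE BLOCK PAIRING of the class of
`(x, x+d)` (four entries: `(x,x+d)`, `(x+d,x)` and their conjugate partners `(−x−d,−x)`, `(−x,−x−d)`),
`σ_x(p,q) := Re⟪p, A x (x+d) q⟫ + Re⟪q, A (x+d) x p⟫ + Re⟪q̄, A (−x−d) (−x) p̄⟫ + Re⟪p̄, A (−x) (−x−d) q̄⟫`, and
`Dead x :⟺ σ_x(p,q) = 0` for all `p ⊥ x`, `q ⊥ x + d` (bilinear `Σ xⱼ pⱼ = 0`). Then: (SYM) `Dead x → Dead (−x−d)`;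
(ONE-SHOT) `x, x+d, 2x+d ∈ S`, `x ∦ d`, `|x|² ≠ |2x+d|²` ⇒ `Dead x`; (CHAIN, needs `d ∈ S`) `x, x+d ∈ S`, `x ∦ d`, `|x|² ≠ |d|²`,
block `(x−d, x)` dead-or-absent ⇒ `Dead x`; (ISOLATION) `a, b ∈ S`, `a ∦ b`, `|a|² ≠ |b|²`, `a+b, a+b+d ∈ S`, `r := −d−a−b ∉ {±a,±b}`,
blocks `(−d−a, −a)` and `(−d−b, −b)` dead-or-absent ⇒ `Dead (a+b)`; (FORM) if every present block is dead the form vanishes on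
admissible families. Why true (verified numerically by the lead, compute/killclosure/identities.py): evaluate the Casimir identity at
sums of ELEMENTARY admissible families `e(k,v) = v at k, v̄ at −k` and extract multilinear components by real scaling:
ISOLATION — the `(1,1,1)` component of the drift at `e(a,v_a)+e(b,v_b)+e(r,v_r)` (`a+b+r = −d`) is
`Θ_r + Θ_a + Θ_b`, `Θ_r = σ_{a+b}(i·P_{a+b}Γ_r, v̄_r)`, `Γ_r = 2π[(v_a·b)v_b + (v_b·a)v_a]` (present iff `a+b ∈ S`), cyclically;
ONE-SHOT — the `s²t` coefficient of the drift at `s•e(x,v) + t•e(2x+d,w)` is `σ_x(v, i·P_{x+d}G)`, `G = 2π[(v̄·(2x+d))w − (w·x)v̄]`;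
CHAIN — the `st²` coefficient at `s•e(d,w) + t•e(x,v)` is `σ_x(v, i·P_{x+d}Γ₊) + σ_{x−d}(i·P_{x−d}Γ₋, v)`, `Γ₊ = 2π[(w·x)v + (v·d)w]`,
`Γ₋ = 2π[(w̄·x)v − (v·d)w̄]` (each present iff its block is). With dead/absent side blocks the target pairing vanishes on the
image of the couplings; split `σ_x(p,q) = Re⟪p, L q⟫` (`L` complex, compress by `P_x`, `P_{x+d}`) into `Re L`, `Im L` using real and
`i`•real amplitudes, and apply `localRank` (one-shot with `(k,d') := (−x, 2x+d)`, chain with `(k,d') := (x,d)`) / `isolationRank`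
(isolation, `n := P_{a+b}(Im L)u_r`). FORM: `Σ_x ρ_x(c x, c(x+d))` reindexed by the involution `x ↦ −x−d` is `½ Σ_x σ_x = 0`.
Infrastructure: `…DiagonalClassificationExtraction/ExtractionReal` (Fin-6 addition table, `indep_of_cross_ne_zero`, `cx_*` lemmas). -/
theorem stub_killRules :
    (∀ (k d : Fin 3 → ℝ) (M : Matrix (Fin 3) (Fin 3) ℝ),
      crossProduct k d ≠ 0 → dotProduct k k ≠ dotProduct d d →
      M.mulVec k = 0 → Matrix.vecMul (k + d) M = 0 →
      (∀ v ω : Fin 3 → ℝ, dotProduct v k = 0 → dotProduct ω d = 0 →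
        dotProduct v d * dotProduct ω (M.mulVec v) + dotProduct ω k * dotProduct v (M.mulVec v) = 0) →
      M = 0) →
    (∀ a b n : Fin 3 → ℝ, crossProduct a b ≠ 0 → dotProduct a a ≠ dotProduct b b →
      dotProduct n (a + b) = 0 →
      (∀ x y : Fin 3 → ℝ, dotProduct x a = 0 → dotProduct y b = 0 →
        dotProduct x b * dotProduct n y + dotProduct y a * dotProduct n x = 0) →
      n = 0) →
    ∀ (N : ℕ) (d : Fin 3 → ℤ) (A : ((Fin 3 → ℤ) → (Fin 3 → ℤ) → (EuclideanSpace ℂ (Fin 3) →ₗ[ℂ] EuclideanSpace ℂ (Fin 3)))), d ≠ 0 →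
      (∀ k l : Fin 3 → ℤ, l - k ≠ d → l - k ≠ -d → A k l = 0) →
      (∀ c : (Fin 3 → ℤ) → EuclideanSpace ℂ (Fin 3), (Torus.IsConjSymm c ∧ Torus.IsTransversal ((Torus.freqBall N).erase (0 : Fin 3 → ℤ)) c ∧
          ∀ k ∉ ((Torus.freqBall N).erase (0 : Fin 3 → ℤ)), c k = 0) →
          ∑ k ∈ ((Torus.freqBall N).erase (0 : Fin 3 → ℤ)), ∑ l ∈ ((Torus.freqBall N).erase (0 : Fin 3 → ℤ)),
            ((inner ℂ (Torus.leraySym k (Torus.convectionCoeff ((Torus.freqBall N).erase (0 : Fin 3 → ℤ)) c c k)) (A k l (c l))).re +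
              (inner ℂ (c k) (A k l (Torus.leraySym l (Torus.convectionCoeff ((Torus.freqBall N).erase (0 : Fin 3 → ℤ)) c c l)))).re) = 0) →
      ∀ Dead : (Fin 3 → ℤ) → Prop,
        (∀ x : Fin 3 → ℤ, Dead x ↔ ∀ p q : EuclideanSpace ℂ (Fin 3), (∑ j, ((x j : ℤ) : ℂ) * p j) = 0 → (∑ j, (((x + d) j : ℤ) : ℂ) * q j) = 0 →
          ((inner ℂ p ((A x (x + d)) q)).re + (inner ℂ q ((A (x + d) x) p)).re +
            (inner ℂ (EuclideanSpace.conjVec q) ((A (-(x + d)) (-x)) (EuclideanSpace.conjVec p))).re +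
            (inner ℂ (EuclideanSpace.conjVec p) ((A (-x) (-(x + d))) (EuclideanSpace.conjVec q))).re) = 0) →
        (∀ x : Fin 3 → ℤ, Dead x → Dead (-x - d)) ∧
        (∀ x : Fin 3 → ℤ, x ∈ ((Torus.freqBall N).erase (0 : Fin 3 → ℤ)) → x + d ∈ ((Torus.freqBall N).erase (0 : Fin 3 → ℤ)) → 2 • x + d ∈ ((Torus.freqBall N).erase (0 : Fin 3 → ℤ)) →
          crossProduct x d ≠ 0 → x ⬝ᵥ x ≠ (2 • x + d) ⬝ᵥ (2 • x + d) → Dead x) ∧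
        (d ∈ ((Torus.freqBall N).erase (0 : Fin 3 → ℤ)) → ∀ x : Fin 3 → ℤ, x ∈ ((Torus.freqBall N).erase (0 : Fin 3 → ℤ)) → x + d ∈ ((Torus.freqBall N).erase (0 : Fin 3 → ℤ)) →
          crossProduct x d ≠ 0 → x ⬝ᵥ x ≠ d ⬝ᵥ d → (x - d ∈ ((Torus.freqBall N).erase (0 : Fin 3 → ℤ)) → Dead (x - d)) → Dead x) ∧
        (∀ a b : Fin 3 → ℤ, a ∈ ((Torus.freqBall N).erase (0 : Fin 3 → ℤ)) → b ∈ ((Torus.freqBall N).erase (0 : Fin 3 → ℤ)) → crossProduct a b ≠ 0 → a ⬝ᵥ a ≠ b ⬝ᵥ b →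
          a + b ∈ ((Torus.freqBall N).erase (0 : Fin 3 → ℤ)) → a + b + d ∈ ((Torus.freqBall N).erase (0 : Fin 3 → ℤ)) →
          -d - a - b ≠ a → -d - a - b ≠ -a → -d - a - b ≠ b → -d - a - b ≠ -b →
          (-d - a ∈ ((Torus.freqBall N).erase (0 : Fin 3 → ℤ)) → Dead (-d - a)) → (-d - b ∈ ((Torus.freqBall N).erase (0 : Fin 3 → ℤ)) → Dead (-d - b)) → Dead (a + b)) ∧
        ((∀ x : Fin 3 → ℤ, x ∈ ((Torus.freqBall N).erase (0 : Fin 3 → ℤ)) → x + d ∈ ((Torus.freqBall N).erase (0 : Fin 3 → ℤ)) → Dead x) →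
          ∀ c : (Fin 3 → ℤ) → EuclideanSpace ℂ (Fin 3), (Torus.IsConjSymm c ∧ Torus.IsTransversal ((Torus.freqBall N).erase (0 : Fin 3 → ℤ)) c ∧
          ∀ k ∉ ((Torus.freqBall N).erase (0 : Fin 3 → ℤ)), c k = 0) → (∑ k ∈ ((Torus.freqBall N).erase (0 : Fin 3 → ℤ)), ∑ l ∈ ((Torus.freqBall N).erase (0 : Fin 3 → ℤ)), (inner ℂ (c k) (A k l (c l))).re) = 0) := by
  sorry

/-- **S3a-iii `stub_covariantClosure` — THE COMBINATORIAL SWEEP (size L; pure lattice geometry, no kernels; reshaped out of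
the old S3a).** For `N ≥ 3`, `d ≠ 0` and ANY predicate `Dead` on `ℤ³` closed under the four rule schemas of `stub_killRules`
(symmetry `x ↦ −x−d`; one-shot; chain from a dead-or-absent neighbour `(x−d,x)` when `d ∈ S`; isolation from two dead-or-absent
side blocks), every `x` with `x, x + d ∈ S` is `Dead`. Why true (the lead's closure computation, compute/killclosure/main3.py:
complete kill for every defect at every `3 ≤ N ≤ 13`, two rounds; fails at `N = 2` on the axis pairs): for `|d| ≤ N` the chains
from the two ends of each non-collinear ladder `x + ℤd ∩ S` kill every block except the EQUILATERAL ones (`|x| = |x+d| = |d|`: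
two lattice points of norm `|d|` on a line of direction `d` are consecutive — chord lemma), one-shot kills equilateral blocks with
`3|d|² ≤ N²`, and one isolation round (explicit splits `a + b = −x−d` into non-collinear non-equilateral or absent side blocks)
kills the remaining equilateral and then the collinear blocks; for `|d| > N` one-shot plus ONE isolation round with two ABSENT
side blocks (`|a+d|, |b+d| > N`) suffices. The prover must turn these into explicit constructions with inequalities
(`nlinarith`/`omega` on coordinates); `N₁ = 3`. -/
theorem stub_covariantClosure :
    ∀ (N : ℕ) (d : Fin 3 → ℤ) (Dead : (Fin 3 → ℤ) → Prop), 3 ≤ N → d ≠ 0 →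
      (∀ x : Fin 3 → ℤ, Dead x → Dead (-x - d)) →
      (∀ x : Fin 3 → ℤ, x ∈ ((Torus.freqBall N).erase (0 : Fin 3 → ℤ)) → x + d ∈ ((Torus.freqBall N).erase (0 : Fin 3 → ℤ)) → 2 • x + d ∈ ((Torus.freqBall N).erase (0 : Fin 3 → ℤ)) →
          crossProduct x d ≠ 0 → x ⬝ᵥ x ≠ (2 • x + d) ⬝ᵥ (2 • x + d) → Dead x) →
      (d ∈ ((Torus.freqBall N).erase (0 : Fin 3 → ℤ)) → ∀ x : Fin 3 → ℤ, x ∈ ((Torus.freqBall N).erase (0 : Fin 3 → ℤ)) → x + d ∈ ((Torus.freqBall N).erase (0 : Fin 3 → ℤ)) →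
          crossProduct x d ≠ 0 → x ⬝ᵥ x ≠ d ⬝ᵥ d → (x - d ∈ ((Torus.freqBall N).erase (0 : Fin 3 → ℤ)) → Dead (x - d)) → Dead x) →
      (∀ a b : Fin 3 → ℤ, a ∈ ((Torus.freqBall N).erase (0 : Fin 3 → ℤ)) → b ∈ ((Torus.freqBall N).erase (0 : Fin 3 → ℤ)) → crossProduct a b ≠ 0 → a ⬝ᵥ a ≠ b ⬝ᵥ b →
          a + b ∈ ((Torus.freqBall N).erase (0 : Fin 3 → ℤ)) → a + b + d ∈ ((Torus.freqBall N).erase (0 : Fin 3 → ℤ)) →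
          -d - a - b ≠ a → -d - a - b ≠ -a → -d - a - b ≠ b → -d - a - b ≠ -b →
          (-d - a ∈ ((Torus.freqBall N).erase (0 : Fin 3 → ℤ)) → Dead (-d - a)) → (-d - b ∈ ((Torus.freqBall N).erase (0 : Fin 3 → ℤ)) → Dead (-d - b)) → Dead (a + b)) →
      ∀ x : Fin 3 → ℤ, x ∈ ((Torus.freqBall N).erase (0 : Fin 3 → ℤ)) → x + d ∈ ((Torus.freqBall N).erase (0 : Fin 3 → ℤ)) → Dead x := by
  sorry

/-- **Covariant vanishing** (the old stub S3a, statement unchanged — now PROVED from S3a-i/ii/iii): fed the two engines,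
beyond `N₁ = 3` every Casimir kernel has a Casimir diagonal part and its form equals its diagonal form on admissible families.
Pure logic: regroup by defect (S3a-i (3)), and for each `d ≠ 0` the truncated kernel is a supported Casimir (S3a-i (2)) all of
whose present blocks are dead (S3a-ii rules + S3a-iii sweep), hence has zero form (S3a-ii FORM). -/
theorem covariantVanishing :
    (∀ (k d : Fin 3 → ℝ) (M : Matrix (Fin 3) (Fin 3) ℝ),
      crossProduct k d ≠ 0 → dotProduct k k ≠ dotProduct d d →
      M.mulVec k = 0 → Matrix.vecMul (k + d) M = 0 →
      (∀ v ω : Fin 3 → ℝ, dotProduct v k = 0 → dotProduct ω d = 0 →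
        dotProduct v d * dotProduct ω (M.mulVec v) + dotProduct ω k * dotProduct v (M.mulVec v) = 0) →
      M = 0) →
    (∀ a b n : Fin 3 → ℝ, crossProduct a b ≠ 0 → dotProduct a a ≠ dotProduct b b →
      dotProduct n (a + b) = 0 →
      (∀ x y : Fin 3 → ℝ, dotProduct x a = 0 → dotProduct y b = 0 →
        dotProduct x b * dotProduct n y + dotProduct y a * dotProduct n x = 0) →
      n = 0) →
    ∃ N₁ : ℕ, ∀ N : ℕ, N₁ ≤ N → ∀ A : ((Fin 3 → ℤ) → (Fin 3 → ℤ) → (EuclideanSpace ℂ (Fin 3) →ₗ[ℂ] EuclideanSpace ℂ (Fin 3))),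
      (∀ c : (Fin 3 → ℤ) → EuclideanSpace ℂ (Fin 3), (Torus.IsConjSymm c ∧ Torus.IsTransversal ((Torus.freqBall N).erase (0 : Fin 3 → ℤ)) c ∧
          ∀ k ∉ ((Torus.freqBall N).erase (0 : Fin 3 → ℤ)), c k = 0) →
          ∑ k ∈ ((Torus.freqBall N).erase (0 : Fin 3 → ℤ)), ∑ l ∈ ((Torus.freqBall N).erase (0 : Fin 3 → ℤ)),
            ((inner ℂ (Torus.leraySym k (Torus.convectionCoeff ((Torus.freqBall N).erase (0 : Fin 3 → ℤ)) c c k)) (A k l (c l))).re +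
              (inner ℂ (c k) (A k l (Torus.leraySym l (Torus.convectionCoeff ((Torus.freqBall N).erase (0 : Fin 3 → ℤ)) c c l)))).re) = 0) →
      (∀ c : (Fin 3 → ℤ) → EuclideanSpace ℂ (Fin 3), (Torus.IsConjSymm c ∧ Torus.IsTransversal ((Torus.freqBall N).erase (0 : Fin 3 → ℤ)) c ∧
          ∀ k ∉ ((Torus.freqBall N).erase (0 : Fin 3 → ℤ)), c k = 0) →
          ∑ k ∈ ((Torus.freqBall N).erase (0 : Fin 3 → ℤ)),
            ((inner ℂ (Torus.leraySym k (Torus.convectionCoeff ((Torus.freqBall N).erase (0 : Fin 3 → ℤ)) c c k)) ((A k k) (c k))).re +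
              (inner ℂ (c k) ((A k k) (Torus.leraySym k (Torus.convectionCoeff ((Torus.freqBall N).erase (0 : Fin 3 → ℤ)) c c k)))).re) = 0) ∧
      (∀ c : (Fin 3 → ℤ) → EuclideanSpace ℂ (Fin 3), (Torus.IsConjSymm c ∧ Torus.IsTransversal ((Torus.freqBall N).erase (0 : Fin 3 → ℤ)) c ∧
          ∀ k ∉ ((Torus.freqBall N).erase (0 : Fin 3 → ℤ)), c k = 0) →
          (∑ k ∈ ((Torus.freqBall N).erase (0 : Fin 3 → ℤ)), ∑ l ∈ ((Torus.freqBall N).erase (0 : Fin 3 → ℤ)), (inner ℂ (c k) (A k l (c l))).re) = (∑ k ∈ ((Torus.freqBall N).erase (0 : Fin 3 → ℤ)), (inner ℂ (c k) ((A k k) (c k))).re)) := by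
  intro hloc hiso
  refine ⟨3, fun N hN A hA => ?_⟩
  obtain ⟨hdiag, htr, hregroup⟩ := stub_isotypeDecoupling N A hA
  refine ⟨hdiag, fun c hc => ?_⟩
  rw [hregroup c hc]
  have hzero : ∀ d ∈ (Fintype.piFinset fun _ : Fin 3 => Finset.Icc (-(2 * (N : ℤ))) (2 * (N : ℤ))).erase 0,
      (∑ k ∈ ((Torus.freqBall N).erase (0 : Fin 3 → ℤ)), ∑ l ∈ ((Torus.freqBall N).erase (0 : Fin 3 → ℤ)), (inner ℂ (c k) ((fun k l => if l - k = d ∨ l - k = -d then A k l else 0) k l (c l))).re) = 0 := by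
    intro d hd
    have hd0 : d ≠ 0 := (Finset.mem_erase.1 hd).1
    have hsupp : ∀ k l : Fin 3 → ℤ, l - k ≠ d → l - k ≠ -d →
        (fun k l => if l - k = d ∨ l - k = -d then A k l else 0) k l = 0 := by
      intro k l h1 h2
      simp only [h1, h2, or_self, if_false]
    obtain ⟨hsym, hone, hchl, hisol, hform⟩ :=
      stub_killRules hloc hiso N d (fun k l => if l - k = d ∨ l - k = -d then A k l else 0) hd0 hsupp (htr d hd0)
        (fun x => ∀ p q : EuclideanSpace ℂ (Fin 3), (∑ j, ((x j : ℤ) : ℂ) * p j) = 0 → (∑ j, (((x + d) j : ℤ) : ℂ) * q j) = 0 →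
          ((inner ℂ p (((fun k l => if l - k = d ∨ l - k = -d then A k l else 0) x (x + d)) q)).re + (inner ℂ q (((fun k l => if l - k = d ∨ l - k = -d then A k l else 0) (x + d) x) p)).re +
            (inner ℂ (EuclideanSpace.conjVec q) (((fun k l => if l - k = d ∨ l - k = -d then A k l else 0) (-(x + d)) (-x)) (EuclideanSpace.conjVec p))).re +
            (inner ℂ (EuclideanSpace.conjVec p) (((fun k l => if l - k = d ∨ l - k = -d then A k l else 0) (-x) (-(x + d))) (EuclideanSpace.conjVec q))).re) = 0)
        (fun x => Iff.rfl)
    exact hform (stub_covariantClosure N d _ hN hd0 hsym hone hchl hisol) c hc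
  rw [Finset.sum_eq_zero hzero, mul_zero, add_zero]

/-- **S3b `stub_diagonalClassification` — TRANSLATION-INVARIANT CASIMIRS ARE `span{E, H}`
(Kraichnan 1973 JFM 59 §2, doi:10.1017/s0022112073001837, asserted; DHV 1985 p. 219; made a theorem
here).**  Beyond a threshold `N₁`, every block-diagonal kernel `D` whose form `Σ_k Re⟪c k, D k (c k)⟫` is a
Casimir of level-`N` Galerkin–Euler is, on admissible families, `a·Σ_k ‖c k‖² + b·Σ_k Re⟪c k, 2πi k × c k⟫`
(`= a‖u‖²_{L²} + b (u, curl u)` by Parseval, `curlCoeff`/`curl_realTrigPoly`).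
Why true: momentum-`0` monomials `{p, q, k}`, `p+q+k = 0`, carry no truncation-dependent coefficient, so
TI Casimirs RESTRICT from level `N+1` to level `N`; `E`, `H` are Casimirs at every level
(`sum_re_inner_galerkinField_self`; `integral_inner_convect_self_curl_eq_zero`); subtract `aE + bH` fitted
on the ball of radius `N`; each new-shell block `D k` is then pinned to `0` by ONE inner triad
`−k = p + q`, `p, q` in the smaller ball, `|p| ≠ |q|`, `p ∦ q` (map (B) = `isolationRank`, injective; exists for
`N ≥ 5` by balanced rounding of `−k/2 ±` a unit, triage r1-2), so induction from an exact-rank base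
level (`N ∈ {3,4}`: nullity 2 in exact arithmetic, evidence inv_N3/inv_N4, casimir_sweep R2 ≤ 11;
the 18-mode accident `|k|² ≤ 2` sits below every integer ball ≥ 2).  Alternative base-free route: Waleffe's
per-helical-triad relation `σ_k X_k + σ_p X_p + σ_q X_q = 0` has local solutions `span{1, s|k|}`, glued
along triads sharing two helical modes.  Why it might fail: only through a wrong base case (then raise
`N₁`).  Size L. [cite: Kraichnan1973, §2] -/
theorem stub_diagonalClassification :
    ∃ N₁ : ℕ, ∀ N : ℕ, N₁ ≤ N → ∀ D : ((Fin 3 → ℤ) → (EuclideanSpace ℂ (Fin 3) →ₗ[ℂ] EuclideanSpace ℂ (Fin 3))),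
      (∀ c : (Fin 3 → ℤ) → EuclideanSpace ℂ (Fin 3), (Torus.IsConjSymm c ∧ Torus.IsTransversal ((Torus.freqBall N).erase (0 : Fin 3 → ℤ)) c ∧
          ∀ k ∉ (Torus.freqBall N).erase (0 : Fin 3 → ℤ), c k = 0) →
          ∑ k ∈ ((Torus.freqBall N).erase (0 : Fin 3 → ℤ)),
            ((inner ℂ (Torus.leraySym k (Torus.convectionCoeff ((Torus.freqBall N).erase (0 : Fin 3 → ℤ)) c c k)) (D k (c k))).re +
              (inner ℂ (c k) (D k (Torus.leraySym k (Torus.convectionCoeff ((Torus.freqBall N).erase (0 : Fin 3 → ℤ)) c c k)))).re) = 0) →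
      ∃ a b : ℝ, ∀ c : (Fin 3 → ℤ) → EuclideanSpace ℂ (Fin 3), (Torus.IsConjSymm c ∧ Torus.IsTransversal ((Torus.freqBall N).erase (0 : Fin 3 → ℤ)) c ∧
          ∀ k ∉ (Torus.freqBall N).erase (0 : Fin 3 → ℤ), c k = 0) →
        (∑ k ∈ ((Torus.freqBall N).erase (0 : Fin 3 → ℤ)), (inner ℂ (c k) (D k (c k))).re) =
          a * (∑ k ∈ ((Torus.freqBall N).erase (0 : Fin 3 → ℤ)), ‖c k‖ ^ 2) + b * (∑ k ∈ ((Torus.freqBall N).erase (0 : Fin 3 → ℤ)), (inner ℂ (c k) (IntermittentBeltrami.curlCoeff c k)).re) :=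
  Summit.AnomalousDissipation.AnomalousDissipation.Theorems.MomentParityCubicParityLoud.stub_diagonalClassification

/-! ### Bridge: coefficient classification ⇒ test-side QuadRigidity (shared with `QuarticGate/recession-cone` S2(ii)) -/

/-- **S3c `stub_coefficientBridge` — PARSEVAL DICTIONARY.**  At a fixed level `N`: if every coefficient
kernel whose form is a Casimir is `a·energy + b·helicity` on admissible families, then every HOMOGENEOUS
QUADRATIC cylindrical observable `p(u) = P((u,g₁),…,(u,gₘ))` (band-limited tests) whose Euler derivative
`nsGeneratorPairing 0 0 u (∇p(u)) = ∫ (u⊗u):∇(∇p(u))` vanishes at every level-`N` field has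
`∇p(u) = 2α P_N u + 2β curl P_N u` at level-`N` fields — literally the QuadRigidity clause of
`recession-cone.stub_casimirs` (ii) / hypothesis of `stub_order3Surgery`.
Why true (bookkeeping, no idea): `(u, gⱼ) = Σ_k Re⟪û k, ĝⱼ k⟫` (`integral_inner_realTrigPoly_left`), so
`p|_{V_N}` is the form of the explicit kernel `A k l = Σ_{ij} P_{ij} ĝᵢ(k) ⟪ĝⱼ(l), ·⟫`; for the level-`N`
field `u = realTrigPoly ball c` one has `inertialPairing u (Su) = −∫⟪(u·∇)u, Su⟫`
(`integral_inner_convect_eq_neg`) `= −Σ_k Re⟪convectionCoeff … k, (Su)^(k)⟫`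
(`mFourierCoeff_convect_realTrigPoly`, Parseval) = the coefficient derivative of the form, so the
hypothesis is the coefficient Casimir identity; the classification gives `p(u) = a‖P_N u‖² + b(P_N u, curl P_N u)`
(`integral_norm_sq_realTrigPoly`, `curl_realTrigPoly`), and differentiating inside `V_N` (both sides of the
conclusion are `V_N`-valued continuous fields, equal after pairing with every `v ∈ V_N`) gives the
differential with `α = a`, `β = b`.  Size M–L. [folklore] -/
theorem stub_coefficientBridge :
    ∀ N : ℕ,
    (∀ A : ((Fin 3 → ℤ) → (Fin 3 → ℤ) → (EuclideanSpace ℂ (Fin 3) →ₗ[ℂ] EuclideanSpace ℂ (Fin 3))),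
        (∀ c : (Fin 3 → ℤ) → EuclideanSpace ℂ (Fin 3), (Torus.IsConjSymm c ∧ Torus.IsTransversal ((Torus.freqBall N).erase (0 : Fin 3 → ℤ)) c ∧
          ∀ k ∉ (Torus.freqBall N).erase (0 : Fin 3 → ℤ), c k = 0) →
          ∑ k ∈ ((Torus.freqBall N).erase (0 : Fin 3 → ℤ)), ∑ l ∈ ((Torus.freqBall N).erase (0 : Fin 3 → ℤ)),
            ((inner ℂ (Torus.leraySym k (Torus.convectionCoeff ((Torus.freqBall N).erase (0 : Fin 3 → ℤ)) c c k)) (A k l (c l))).re +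
              (inner ℂ (c k) (A k l (Torus.leraySym l (Torus.convectionCoeff ((Torus.freqBall N).erase (0 : Fin 3 → ℤ)) c c l)))).re) = 0) →
        ∃ a b : ℝ, ∀ c : (Fin 3 → ℤ) → EuclideanSpace ℂ (Fin 3), (Torus.IsConjSymm c ∧ Torus.IsTransversal ((Torus.freqBall N).erase (0 : Fin 3 → ℤ)) c ∧
          ∀ k ∉ (Torus.freqBall N).erase (0 : Fin 3 → ℤ), c k = 0) →
          (∑ k ∈ ((Torus.freqBall N).erase (0 : Fin 3 → ℤ)), ∑ l ∈ ((Torus.freqBall N).erase (0 : Fin 3 → ℤ)), (inner ℂ (c k) (A k l (c l))).re) =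
            a * (∑ k ∈ ((Torus.freqBall N).erase (0 : Fin 3 → ℤ)), ‖c k‖ ^ 2) + b * (∑ k ∈ ((Torus.freqBall N).erase (0 : Fin 3 → ℤ)), (inner ℂ (c k) (IntermittentBeltrami.curlCoeff c k)).re)) →
    (∀ (m : ℕ) (g : Fin m → UnitAddTorus (Fin 3) → EuclideanSpace ℝ (Fin 3))
      (P : MvPolynomial (Fin m) ℝ),
      (∀ i, (Torus.IsSmooth (g i) ∧ Torus.IsDivFree (g i) ∧ Torus.HasZeroMean (g i) ∧
        ∀ k ∉ (Torus.freqBall N).erase (0 : Fin 3 → ℤ),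
          UnitAddTorus.mFourierCoeff (EuclideanSpace.complexify ∘ (g i)) k = 0)) → P.IsHomogeneous 2 →
      (∀ u : Torus.energySpace (Fin 3), (∀ k ∉ (Torus.freqBall N).erase (0 : Fin 3 → ℤ),
          UnitAddTorus.mFourierCoeff (EuclideanSpace.complexify ∘ (u.1 : UnitAddTorus (Fin 3) → EuclideanSpace ℝ (Fin 3))) k = 0) →
        Torus.nsGeneratorPairing (d := Fin 3) 0 0 u
          (fun x => ∑ i, (MvPolynomial.eval (fun j => Torus.pairing u.1 (g j))
            (MvPolynomial.pderiv i P)) • g i x) = 0) →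
      ∃ α β : ℝ, ∀ u : Torus.energySpace (Fin 3), (∀ k ∉ (Torus.freqBall N).erase (0 : Fin 3 → ℤ),
          UnitAddTorus.mFourierCoeff (EuclideanSpace.complexify ∘ (u.1 : UnitAddTorus (Fin 3) → EuclideanSpace ℝ (Fin 3))) k = 0) →
        ∀ x, (∑ i, (MvPolynomial.eval (fun j => Torus.pairing u.1 (g j))
            (MvPolynomial.pderiv i P)) • g i x) =
          (2 * α) • Torus.fourierTruncate N (u.1 : UnitAddTorus (Fin 3) → EuclideanSpace ℝ (Fin 3)) x +
          (2 * β) • BDSV.curl (Torus.fourierTruncate N (u.1 : UnitAddTorus (Fin 3) → EuclideanSpace ℝ (Fin 3))) x) := by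
  sorry

/-! ## The kill S4 (reshaped non-triviality) and the construction S5 (the menu) -/

/-- **S4 — `stub_noCasimirCertificate`: THE MENU KILLS EVERY CASIMIR-BASED CERTIFICATE (the Farkas
split proper).** Fix a smooth force `f`, `ν > 0`, a level `N`, budgets `E`, `ε > 0` and a dial radius
`δ > 0`. Assume QuadRigidity at level `N` (the conclusion of S3 at this `N`) and the BALANCED MENU at
`(f, ν, N)`: for every dial `(a, b) ∈ [−δ, δ]²` a probability law on `H` carried by level-`N` fields,
with finite third moments, 1-STATIONARY (every LINEAR row `∫⟨F_ν(u), g⟩dμ = 0`, `g` band-limited),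
with ENERGY DRIFT `∫⟨F_ν(u), P_N u⟩dμ = a`, HELICITY DRIFT `∫⟨F_ν(u), curl P_N u⟩dμ = b`, energy `≤ E`
and dissipation `≥ 2ε`. Then no weak certificate at the target constants `(E + 1, ε)` whose test has
a Casimir quadratic part exists.
Why true (finite-dimensional, each step elementary): write `∇p(u) = G₀ + ∇p₂(u)` with the CONSTANT
band-limited field `G₀ = ∇p(0) = Σᵢ ∂ᵢP(0) gᵢ` (`deg P ≤ 2`); QuadRigidity on `p₂` gives
`∇p₂(u) = 2α P_N u + 2β curl P_N u` at level-`N` fields, so by linearity in the test field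
(`nsGeneratorPairing_sum_smul`) the certificate integrates against `μ_{a,b}` (a.e. level-`N`;
integrability: menu clauses, `integrable_norm_pow_of_cube`, Bernstein `eGradNormSq_le_of_isLevel`,
`∫ ν‖∇u‖² dμ = ensembleDissipation ν μ`) to
`0 + 2αa + 2βb + λ_b((E+1) − energy) + λ_c(dissipation − ε) ≤ 0` with `(E+1) − energy ≥ 1`,
`dissipation − ε ≥ ε`: dial `(0,0)` ⇒ `λ_b = λ_c = 0`; dials `(±δ, 0)`, `(0, ±δ)` ⇒ `α = β = 0`. Hence
`∇p(u) = G₀` on level-`N` fields and `(f, G₀) + ν(u, ΔG₀) + ∫(u⊗u):∇G₀ ≤ 0` for all level-`N` `u`: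
the quadratic form `u ↦ ∫(u⊗u):∇G₀ = −(B(u,u), G₀)` on `V_N` is `≤ 0` (scaling) and has zero trace
over the Parseval frame of single real Fourier modes (`Torus.frameField`, each a steady Euler state:
`(e·∇)e = 0` for `e = a cos(2πk·x)`, `a ⊥ k`; `sum_integral_inner_frameField_sq`), so it vanishes; then
the affine residual forces `(u, ΔG₀) = 0` for all `u ∈ V_N`, in particular `‖∇G₀‖² = 0`, `G₀ = 0`
(mean zero; HERE `ν > 0` is used). So `∇p ≡ 0` on level-`N` fields, `p` is constant there
(segments stay at level `N`), contradicting non-triviality. Size M–L. -/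
theorem stub_noCasimirCertificate :
    ∀ f : T3 → R3, Torus.IsSmooth f → ∀ ν : ℝ, 0 < ν → ∀ (N : ℕ) (E ε δ : ℝ), 0 < ε → 0 < δ →
      -- QuadRigidity at level `N` (conclusion of S3 at this level)
      (∀ (m : ℕ) (g : Fin m → T3 → R3) (P : MvPolynomial (Fin m) ℝ),
        (∀ i, IsBandTest N (g i)) → P.IsHomogeneous 2 →
        (∀ u : H3, IsLevel N u →
            Torus.nsGeneratorPairing (d := Fin 3) 0 0 u (polyGrad g P u) = 0) →
        ∃ α β : ℝ, ∀ u : H3, IsLevel N u → ∀ x : T3,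
          polyGrad g P u x =
            (2 * α) • Torus.fourierTruncate N ((u : L2T3) : T3 → R3) x +
              (2 * β) • BDSV.curl (Torus.fourierTruncate N ((u : L2T3) : T3 → R3)) x) →
      -- the balanced menu at `(f, ν, N)` with dials in `[−δ, δ]²`, budgets `(E, 2ε)`
      (∀ a b : ℝ, |a| ≤ δ → |b| ≤ δ → ∃ μ : Measure H3,
          IsProbabilityMeasure μ ∧ (∀ᵐ u ∂μ, IsLevel N u) ∧
          Integrable (fun u : H3 => ‖u‖ ^ 3) μ ∧
          (∀ g : T3 → R3, IsBandTest N g →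
              Integrable (fun u : H3 => Torus.nsGeneratorPairing ν f u g) μ ∧
                ∫ u, Torus.nsGeneratorPairing ν f u g ∂μ = 0) ∧
          (Integrable (fun u : H3 => Torus.nsGeneratorPairing ν f u
              (Torus.fourierTruncate N ((u : L2T3) : T3 → R3))) μ ∧
            ∫ u, Torus.nsGeneratorPairing ν f u
              (Torus.fourierTruncate N ((u : L2T3) : T3 → R3)) ∂μ = a) ∧
          (Integrable (fun u : H3 => Torus.nsGeneratorPairing ν f u
              (BDSV.curl (Torus.fourierTruncate N ((u : L2T3) : T3 → R3)))) μ ∧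
            ∫ u, Torus.nsGeneratorPairing ν f u
              (BDSV.curl (Torus.fourierTruncate N ((u : L2T3) : T3 → R3))) ∂μ = b) ∧
          Torus.ensembleEnergy μ ≤ E ∧ 2 * ε ≤ Torus.ensembleDissipation ν μ) →
      -- conclusion: no weak certificate at `(E + 1, ε)` with a Casimir quadratic part
      ∀ (m : ℕ) (g : Fin m → T3 → R3) (P : MvPolynomial (Fin m) ℝ) (lb lc : ℝ),
        (∀ i, IsBandTest N (g i)) → P.totalDegree ≤ 2 → 0 ≤ lb → 0 ≤ lc →
        (lb ≠ 0 ∨ lc ≠ 0 ∨ ∃ u : H3, IsLevel N u ∧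
            Torus.nsGeneratorPairing ν f u (polyGrad g P u) ≠ 0) →
        (∀ u : H3, IsLevel N u →
            Torus.nsGeneratorPairing ν f u (polyGrad g P u) + lb * ((E + 1) - ‖u‖ ^ 2) +
              lc * (ν * (Torus.eGradNormSq ((u : L2T3) : T3 → R3)).toReal - ε) ≤ 0) →
        (∀ u : H3, IsLevel N u →
            Torus.nsGeneratorPairing (d := Fin 3) 0 0 u
              (polyGrad g (MvPolynomial.homogeneousComponent 2 P) u) = 0) →
        False :=
  Summit.AnomalousDissipation.AnomalousDissipation.Theorems.MomentParityCubicParityLoud.stub_noCasimirCertificate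

/-- **S5 — `stub_balancedMenu`: THE TWO-DIAL MENU OF 1-STATIONARY ATOM CLOUDS (the only
construction; first and second moments only).** For every smooth divergence-free mean-zero `f ≠ 0`
there are `E`, `ε > 0`, `ν₀ > 0`, `δ > 0` such that for all `ν ∈ (0, ν₀)` and all `N ≥ N₀(ν)`
(`N₀ ≍ ν^{-1/2}`) and every dial `(a, b) ∈ [−δ, δ]²` there is a probability law on `H`, carried by
level-`N` fields, with finite third moments, whose LINEAR rows all vanish (exact mean-flow /
Reynolds-stress balance `P_N f + νΔm = B_N(second moment)`), with energy drift
`∫⟨F_ν(u), P_N u⟩dμ = a`, helicity drift `∫⟨F_ν(u), curl P_N u⟩dμ = b`, energy `≤ E` and dissipation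
`≥ 2ε`.
Why plausibly true (card § Lever, triage r1-2/r1-3 "no defect found"): since `f ≠ 0` is continuous some
`f̂(p₀) ≠ 0`, `p₀ ≠ 0` (mean zero), `f̂(p₀) ⊥ p₀` (div-free) — the three load-bearing hypotheses are
consumed exactly here; MEAN FLOW `m = c · f^{(p₀)}` (the `±p₀` mode pair of `f`, a steady Euler state,
`(f, m) = c‖f^{(p₀)}‖² > 0`); four-phase STRESS PACKETS `Re(e^{iθ}(x e_k + y e_{k+q}))`,
`θ ∈ {0, π/2, π, 3π/2}`, `k = −sign(qᵢ)eᵢ` (so `k + q` stays in the ball), whose covariance lives at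
shift `±q` only and realises `R = P_N f + νΔm` mode by mode at energy `≲ Σ_q |R̂(q)|/|q|` and
enstrophy `≲ Σ_q |q||R̂(q)|`, summable uniformly in `N, ν` for smooth `f`; a random-phase two-helicity
SEA on the Taylor shell `|k|² ≈ K(ν)² = ε/(4π²ν E_sea)` (`K ≍ ν^{-1/2}`, `N₀ := 2K`), translation
invariant (zero mean stress), whose enstrophy sets `dissipation = (f,m) − a` (energy row: `a` dial;
`(f, m) := 4ε + …`) and whose chirality fraction `χ ≍ ν^{1/2}` sets the helicity drift
(capacity `≍ ν K³ E_sea χ ≍ ε K χ`, so `|b| ≤ δ` is reachable). All phases finite ⇒ `μ` is a finite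
convex combination of Diracs at level-`N` trigonometric polynomials; every menu identity is a finite
trigonometric-coefficient computation on sums of single modes (`pair_formula`, `frameField`,
`mFourierCoeff_convect_realTrigPoly`, `toReal_eGradNormSq_realTrigPoly`, `curl_realTrigPoly`,
`integrable_dirac`, `nsGeneratorPairing_sum_smul`). Nearest in-tree relative: `stub_order2Design` (S6) of
line `recession-cone` (one Kolmogorov force, dials `(0,0)`, no slack) — its packet/sea bookkeeping
transfers. Size L (explicit but long). -/
theorem stub_balancedMenu :
    ∀ f : T3 → R3, Torus.IsSmooth f → Torus.IsDivFree f → Torus.HasZeroMean f → f ≠ 0 →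
      ∃ E ε ν₀ δ : ℝ, 0 < ε ∧ 0 < ν₀ ∧ 0 < δ ∧ ∀ ν : ℝ, 0 < ν → ν < ν₀ →
        ∃ N₀ : ℕ, ∀ N : ℕ, N₀ ≤ N → ∀ a b : ℝ, |a| ≤ δ → |b| ≤ δ → ∃ μ : Measure H3,
          IsProbabilityMeasure μ ∧ (∀ᵐ u ∂μ, IsLevel N u) ∧
          Integrable (fun u : H3 => ‖u‖ ^ 3) μ ∧
          (∀ g : T3 → R3, IsBandTest N g →
              Integrable (fun u : H3 => Torus.nsGeneratorPairing ν f u g) μ ∧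
                ∫ u, Torus.nsGeneratorPairing ν f u g ∂μ = 0) ∧
          (Integrable (fun u : H3 => Torus.nsGeneratorPairing ν f u
              (Torus.fourierTruncate N ((u : L2T3) : T3 → R3))) μ ∧
            ∫ u, Torus.nsGeneratorPairing ν f u
              (Torus.fourierTruncate N ((u : L2T3) : T3 → R3)) ∂μ = a) ∧
          (Integrable (fun u : H3 => Torus.nsGeneratorPairing ν f u
              (BDSV.curl (Torus.fourierTruncate N ((u : L2T3) : T3 → R3)))) μ ∧
            ∫ u, Torus.nsGeneratorPairing ν f u
              (BDSV.curl (Torus.fourierTruncate N ((u : L2T3) : T3 → R3))) ∂μ = b) ∧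
          Torus.ensembleEnergy μ ≤ E ∧ 2 * ε ≤ Torus.ensembleDissipation ν μ :=
  Summit.AnomalousDissipation.AnomalousDissipation.Theorems.MomentParityCubicParityLoud.stub_balancedMenu

/-! ## Glue (kernel-checked; no `sorry` outside the stubs) -/

/-- **Coefficient classification beyond a threshold**, glued from S3a (fed the proved engines
`localRank`, `isolationRank`) and S3b: for
`N ≥ N₁` every kernel whose form is a Casimir is `a·energy + b·helicity` on admissible families.
Pure logic: S3a (ii) rewrites the form to its diagonal part, S3a (i) feeds S3b with `D k := A k k`. [folklore] -/
theorem coefficientClassification_eventually :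
    ∃ N₁ : ℕ, ∀ N : ℕ, N₁ ≤ N →
    (∀ A : ((Fin 3 → ℤ) → (Fin 3 → ℤ) → (EuclideanSpace ℂ (Fin 3) →ₗ[ℂ] EuclideanSpace ℂ (Fin 3))),
        (∀ c : (Fin 3 → ℤ) → EuclideanSpace ℂ (Fin 3), (Torus.IsConjSymm c ∧ Torus.IsTransversal ((Torus.freqBall N).erase (0 : Fin 3 → ℤ)) c ∧
          ∀ k ∉ (Torus.freqBall N).erase (0 : Fin 3 → ℤ), c k = 0) →
          ∑ k ∈ ((Torus.freqBall N).erase (0 : Fin 3 → ℤ)), ∑ l ∈ ((Torus.freqBall N).erase (0 : Fin 3 → ℤ)),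
            ((inner ℂ (Torus.leraySym k (Torus.convectionCoeff ((Torus.freqBall N).erase (0 : Fin 3 → ℤ)) c c k)) (A k l (c l))).re +
              (inner ℂ (c k) (A k l (Torus.leraySym l (Torus.convectionCoeff ((Torus.freqBall N).erase (0 : Fin 3 → ℤ)) c c l)))).re) = 0) →
        ∃ a b : ℝ, ∀ c : (Fin 3 → ℤ) → EuclideanSpace ℂ (Fin 3), (Torus.IsConjSymm c ∧ Torus.IsTransversal ((Torus.freqBall N).erase (0 : Fin 3 → ℤ)) c ∧
          ∀ k ∉ (Torus.freqBall N).erase (0 : Fin 3 → ℤ), c k = 0) →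
          (∑ k ∈ ((Torus.freqBall N).erase (0 : Fin 3 → ℤ)), ∑ l ∈ ((Torus.freqBall N).erase (0 : Fin 3 → ℤ)), (inner ℂ (c k) (A k l (c l))).re) =
            a * (∑ k ∈ ((Torus.freqBall N).erase (0 : Fin 3 → ℤ)), ‖c k‖ ^ 2) + b * (∑ k ∈ ((Torus.freqBall N).erase (0 : Fin 3 → ℤ)), (inner ℂ (c k) (IntermittentBeltrami.curlCoeff c k)).re)) := by
  obtain ⟨N₁, hcov⟩ := covariantVanishing localRank isolationRank
  obtain ⟨N₂, hti⟩ := stub_diagonalClassification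
  refine ⟨max N₁ N₂, fun N hN A hA => ?_⟩
  obtain ⟨hdiag, hform⟩ := hcov N (le_of_max_le_left hN) A hA
  obtain ⟨a, b, hab⟩ := hti N (le_of_max_le_right hN) (fun k => A k k) hdiag
  exact ⟨a, b, fun c hc => by rw [hform c hc]; exact hab c hc⟩

/-- **QuadRigidity beyond a threshold** — the statement of the planner's monolithic `stub_quadRigidity`
(old S3), now PROVED from S3a/S3b (via `coefficientClassification_eventually`) and the bridge S3c: beyond
`N₁`, every homogeneous quadratic polynomial cylindrical observable with level-`N` band tests whose Euler
derivative vanishes at every level-`N` field has differential `2α P_N u + 2β curl P_N u` there.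
(`IsBandTest`, `IsLevel`, `polyGrad` are the `Negative.Clauses` names of the unfolded clauses of S3c.) -/
theorem quadRigidity_eventually :
    ∃ N₁ : ℕ, ∀ N : ℕ, N₁ ≤ N →
      ∀ (m : ℕ) (g : Fin m → T3 → R3) (P : MvPolynomial (Fin m) ℝ),
        (∀ i, IsBandTest N (g i)) → P.IsHomogeneous 2 →
        (∀ u : H3, IsLevel N u →
            Torus.nsGeneratorPairing (d := Fin 3) 0 0 u (polyGrad g P u) = 0) →
        ∃ α β : ℝ, ∀ u : H3, IsLevel N u → ∀ x : T3,
          polyGrad g P u x =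
            (2 * α) • Torus.fourierTruncate N ((u : L2T3) : T3 → R3) x +
              (2 * β) • BDSV.curl (Torus.fourierTruncate N ((u : L2T3) : T3 → R3)) x := by
  obtain ⟨N₁, hN₁⟩ := coefficientClassification_eventually
  refine ⟨N₁, fun N hN m g P hg hP hE => ?_⟩
  exact stub_coefficientBridge N (hN₁ N hN) m g P hg hP hE

/-- **`CubicParityLoud` from the seven stubs.** Given `f`, the menu (S5) supplies `(E, ε, ν₀, δ)` and,
for each `ν ∈ (0, ν₀)`, a threshold `N₀`; the classification (S3a/S3b/S3c, glued as
`quadRigidity_eventually`) supplies `N₁`. Answer the crux with `(E + 1, ε, ν₀)` and threshold `max N₀ N₁`.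
At such `N`, by the conic duality (S1) it suffices to exclude weak certificates at `(E + 1, ε)`; a weak
certificate has a Casimir quadratic part (S2) and is then excluded by S4 fed with QuadRigidity at `N` and
the menu at `(f, ν, N)`. Pure logic beyond the stubs; concludes the crux BY NAME through
`Negative.cubicParityLoud_iff` (`Iff.rfl`). -/
theorem CubicParityLoud_of : CubicParityLoud := by
  rw [cubicParityLoud_iff]
  intro f hfs hfd hfz hf0
  obtain ⟨E, ε, ν₀, δ, hε, hν₀, hδ, hmenu⟩ := stub_balancedMenu f hfs hfd hfz hf0
  obtain ⟨N₁, hrig⟩ := quadRigidity_eventually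
  refine ⟨E + 1, ε, ν₀, hε, hν₀, fun ν hν hνlt => ?_⟩
  obtain ⟨N₀, hN₀⟩ := hmenu ν hν hνlt
  refine ⟨max N₀ N₁, fun N hN => ?_⟩
  have hN0 : N₀ ≤ N := le_trans (le_max_left _ _) hN
  have hN1 : N₁ ≤ N := le_trans (le_max_right _ _) hN
  refine stub_farkas f hfs ν N (E + 1) ε ?_
  rintro ⟨m, g, P, lb, lc, hg, hP, hlb, hlc, hnt, hineq⟩
  exact stub_noCasimirCertificate f hfs ν hν N E ε δ hε hδ (hrig N hN1) (hN₀ N hN0)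
    m g P lb lc hg hP hlb hlc hnt hineq
    (stub_cubicCasimir f hfs ν N (E + 1) ε lb lc m g P hg hP hineq)

end Summit.AnomalousDissipation.AnomalousDissipation.Cruxes.CubicParityLoud.FarkasSplitMenu

end
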